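import Literature.NumberTheory.LFunctions.LargeValuesS2Bound
import HarnessLib

/-!
# Guth–Maynard §6, eqs. (6.3)–(6.5), for a general Hölder exponent `k` — NOT RH-BEARING: a density / large-values theorem counts zeros off the line, it never empties the strip (Barrier LindelofBacklund)

NOT RH-BEARING (D-0040): a large-values / zero-density statement COUNTS large values of a Dirichlet
polynomial or zeros off the critical line, it never empties the strip
(`Literature.Barriers.RiemannHypothesis.LindelofBacklund`); nothing in this file bears on the truth of
the Riemann Hypothesis, and nothing here is progress toward it. Cell rh-crit, corpus C4
(Guth–Maynard), work package WP-B1c (towards Proposition 6.1 as printed, with `k` and `T` free);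
bears_on LADDER-RH §4 HELD row `DensityLadder`.

Topic `NumberTheory/LFunctions`, family RH. Source: L. Guth, J. Maynard, *New large value estimates
for Dirichlet polynomials*, Ann. of Math. (2) 203 (2026), 623–675 = arXiv:2405.20552, §6, proof of
Proposition 6.1 after display (6.2). The tree's `LargeValuesS2Bound.lean` (`GuthMaynardS2.*`) carries
out this step with the fixed exponent `k = 4` (Cauchy–Schwarz twice: `dps_le_fourth_root`,
`dps_block_le`, `sum_sq_norm_dirD_le`). The printed proof takes an arbitrary `k ∈ ℕ`:

> "We apply Hölder's inequality to this sum, and rewrite the `2k`-th power of the Dirichlet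
> polynomial as the `2`-nd power of a longer Dirichlet polynomial. For any choice of positive integer
> `k`, we find that `∑_{t₁,t₂∈W} |∑_{m∼M} a_m m^{i(t₁−t₂)}|² ≤ |W|^{2−2/k} (∑_{t₁,t₂∈W} |∑_{m≍M^k}
> b_m m^{i(t₁−t₂)}|²)^{1/k}` (6.3) for some coefficients `b_m ≤ M^{o_k(1)}` (by the divisor bound).
> … [Heath-Brown] … `∑_{t₁,t₂} |∑_{m≍M^k} b_m m^{i(t₁−t₂)}|² ⪅_k |W|²M^k + |W|M^{2k} + |W|^{5/4}T^{1/2}M^k`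
> (6.4)."

This file PROVES that step for every `k ≥ 1`, with the tree's objects
(`DoubleZetaSums.dps W F a = ∑_{t,t'∈W} |∑_{n∈F} a_n n^{i(t−t')}|²`, `GuthMaynardS2.dirD`):

* `pow_sum_twist_eq` (with the private `twist_prod`): the `k`-th power of a Dirichlet polynomial is a Dirichlet
  polynomial indexed by `k`-tuples;
* `card_tuples_prod_eq_le`: the number of `k`-tuples from `F ⊆ ℕ_{≥1}` with product `g` is
  `≤ d(g)^k` (each entry divides `g`);
* `sum_norm_pow_sq_le_dps`: the majorant principle (`DoubleZetaSums.dps_le_of_norm_le`, Ivić's Lemma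
  11.1) gives `∑_{t,t'} |P(t−t')^k|² ≤ D² · dps W G 1` when all `k`-fold products lie in `G` and have
  `≤ D` representations;
* `dps_le_of_pow` — **(6.3)**: `dps W F a ≤ |W|^{2−2/k} (∑_{t,t'} |P(t−t')^k|²)^{1/k}` (Hölder, via the
  power-mean inequality `Real.pow_arith_mean_le_arith_mean_pow`);
* `dps_kadic_range_le` — **(6.4)**: Heath-Brown's theorem (the tree's
  `HeathBrownDZS.heathBrown_differenceSet`, in the form `hCh`) on the `k` dyadic ranges covering
  `(2^{kb}, 2^{kb+k}]`;
* `dps_block_le_k`, `sum_sq_norm_dirD_le_k` — **(6.3)–(6.5) for general `k`**: for every `k ≥ 1`,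
  `ε > 0` there are `C, T₀` with
  `∑_{t,t'∈W} |D_M(t−t'+2πξ)|² ≤ C T^ε (M|W|² + M²|W|^{2−1/k} + M T^{1/(2k)}|W|^{2−3/(4k)})`
  for `T ≥ T₀`, `1 ≤ M ≤ T`, finite `1`-separated `W` in an interval of length `T`, `ξ ∈ ℝ`
  (for `k = 4` this is the tree's `GuthMaynardS2.sum_sq_norm_dirD_le`).

No definition and no named fact is introduced; everything here is proved. The as-printed
Proposition 6.1 (free `k`, free `T`) is assembled from this file in a sequel.

## References

* L. Guth, J. Maynard, *New large value estimates for Dirichlet polynomials*, Ann. of Math. (2) 203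
  (2026), no. 2, 623–675; arXiv:2405.20552: §6, proof of Proposition 6.1, eqs. (6.3)–(6.5) (arXiv v2
  pp. 15–16). [key `GuthMaynard2026`; corpus-tex chunk p0012:L77–L106]
* D. R. Heath-Brown, *A large values estimate for Dirichlet polynomials*, J. London Math. Soc. (2) 20
  (1979), 8–18, Theorem 1 (via `DoubleZetaSumsHeathBrown.lean`).
* A. Ivić, *The Riemann zeta-function*, Wiley 1985, Lemma 11.1 (the majorant principle, via
  `DoubleZetaSums.lean`).
-/

noncomputable section

open Real Complex Finset

namespace Literature.NumberTheory.LFunctions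

namespace GuthMaynardS2K

open DoubleZetaSums GuthMaynardS2 GuthMaynardFourier

/-! ## §1. The `k`-th power of a Dirichlet polynomial -/

/-- `(∏_{i∈s} f i)^{iθ} = ∏_{i∈s} (f i)^{iθ}` (`twist` is multiplicative and `1^{iθ} = 1`). [folklore] -/
private theorem twist_prod {ι : Type*} (s : Finset ι) (f : ι → ℕ) (θ : ℝ) :
    twist (∏ i ∈ s, f i) θ = ∏ i ∈ s, twist (f i) θ := by
  classical
  induction s using Finset.induction_on with
  | empty => simp [twist]
  | insert i s hi ih => rw [Finset.prod_insert hi, Finset.prod_insert hi, twist_mul, ih]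

/-- **The `k`-th power of a Dirichlet polynomial as a sum over `k`-tuples**:
`(∑_{n∈F} a_n n^{iθ})^k = ∑_{f ∈ F^k} (∏_i a_{f_i}) (∏_i f_i)^{iθ}`.
[cite: GuthMaynard2026, Section 6, proof of Proposition 6.1, (6.3)] -/
theorem pow_sum_twist_eq (F : Finset ℕ) (a : ℕ → ℂ) (θ : ℝ) (k : ℕ) :
    (∑ n ∈ F, a n * twist n θ) ^ k =
      ∑ f ∈ Fintype.piFinset (fun _ : Fin k ↦ F), (∏ i, a (f i)) * twist (∏ i, f i) θ := by
  classical
  rw [← Fin.prod_const k (∑ n ∈ F, a n * twist n θ), Finset.prod_univ_sum]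
  refine Finset.sum_congr rfl fun f _ ↦ ?_
  rw [Finset.prod_mul_distrib, twist_prod]

/-- **Tuples with a given product**: for `F ⊆ ℕ` and `g ≠ 0`, the number of `k`-tuples from `F` with
product `g` is at most `d(g)^k` (every entry divides `g`).
[cite: GuthMaynard2026, Section 6, "(by the divisor bound)"] -/
theorem card_tuples_prod_eq_le (F : Finset ℕ) (k : ℕ) {g : ℕ} (hg : g ≠ 0) :
    ((Fintype.piFinset (fun _ : Fin k ↦ F)).filter (fun f ↦ ∏ i, f i = g)).card ≤
      g.divisors.card ^ k := by
  classical
  rw [← Fintype.card_piFinset_const g.divisors k]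
  refine Finset.card_le_card fun f hf ↦ ?_
  rw [Finset.mem_filter] at hf
  rw [Fintype.mem_piFinset]
  intro i
  rw [Nat.mem_divisors]
  refine ⟨?_, hg⟩
  rw [← hf.2]
  exact Finset.dvd_prod_of_mem f (Finset.mem_univ i)

/-- **The `2k`-th moment as a double zeta sum, and the majorant principle**: if every `k`-fold
product of elements of `F ⊆ ℕ_{≥1}` lies in `G ⊆ ℕ_{≥1}` and has at most `D` representations, and
`|a_n| ≤ 1` on `F`, then `∑_{t,t'∈W} |(∑_{n∈F} a_n n^{i(t−t')})^k|² ≤ D² · dps W G 1`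
("rewrite the `2k`-th power of the Dirichlet polynomial as the `2`-nd power of a longer Dirichlet
polynomial … for some coefficients `b_m`"; then Ivić's Lemma 11.1, `DoubleZetaSums.dps_le_of_norm_le`).
[cite: GuthMaynard2026, Section 6, proof of Proposition 6.1, (6.3)] -/
theorem sum_norm_pow_sq_le_dps (W : Finset ℝ) {F G : Finset ℕ} (hG : 0 ∉ G) (k : ℕ)
    (hFG : ∀ f ∈ Fintype.piFinset (fun _ : Fin k ↦ F), (∏ i, f i) ∈ G)
    {a : ℕ → ℂ} (ha : ∀ n ∈ F, ‖a n‖ ≤ 1) {D : ℝ} (hD0 : 0 ≤ D)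
    (hD : ∀ g ∈ G,
      (((Fintype.piFinset (fun _ : Fin k ↦ F)).filter (fun f ↦ ∏ i, f i = g)).card : ℝ) ≤ D) :
    ∑ t ∈ W, ∑ t' ∈ W, ‖(∑ n ∈ F, a n * twist n (t - t')) ^ k‖ ^ 2 ≤
      D ^ 2 * dps W G (fun _ ↦ (1 : ℂ)) := by
  classical
  set S := Fintype.piFinset (fun _ : Fin k ↦ F) with hS
  set e : ℕ → ℂ := fun g ↦ ∑ f ∈ S.filter (fun f ↦ ∏ i, f i = g), ∏ i, a (f i) with he
  -- the power is the Dirichlet polynomial with coefficients `e` on `G`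
  have hexp : ∀ θ : ℝ, (∑ n ∈ F, a n * twist n θ) ^ k = ∑ g ∈ G, e g * twist g θ := by
    intro θ
    rw [pow_sum_twist_eq, ← Finset.sum_fiberwise_of_maps_to hFG]
    refine Finset.sum_congr rfl fun g _ ↦ ?_
    rw [he, Finset.sum_mul]
    refine Finset.sum_congr rfl fun f hf ↦ ?_
    rw [Finset.mem_filter] at hf
    rw [hf.2]
  -- the coefficients are bounded by the representation numbers
  have hebound : ∀ g ∈ G, ‖e g‖ ≤ D := by
    intro g hg
    refine (norm_sum_le _ _).trans ?_
    have h1 : ∀ f ∈ S.filter (fun f ↦ ∏ i, f i = g), ‖∏ i, a (f i)‖ ≤ 1 := by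
      intro f hf
      rw [Finset.mem_filter, hS, Fintype.mem_piFinset] at hf
      rw [norm_prod]
      exact Finset.prod_le_one (fun i _ ↦ norm_nonneg _) (fun i _ ↦ ha _ (hf.1 i))
    calc ∑ f ∈ S.filter (fun f ↦ ∏ i, f i = g), ‖∏ i, a (f i)‖
        ≤ ∑ f ∈ S.filter (fun f ↦ ∏ i, f i = g), (1 : ℝ) := Finset.sum_le_sum h1
      _ = (((S.filter (fun f ↦ ∏ i, f i = g)).card : ℕ) : ℝ) := by simp
      _ ≤ D := hD g hg
  have hlhs : ∑ t ∈ W, ∑ t' ∈ W, ‖(∑ n ∈ F, a n * twist n (t - t')) ^ k‖ ^ 2 = dps W G e := by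
    unfold dps
    refine Finset.sum_congr rfl fun t _ ↦ Finset.sum_congr rfl fun t' _ ↦ ?_
    rw [hexp]
  rw [hlhs]
  calc dps W G e ≤ dps W G (fun _ ↦ ((D : ℝ) : ℂ)) :=
        dps_le_of_norm_le W (subset_refl G) hG hebound (fun _ _ ↦ hD0)
    _ = dps W G (fun _ ↦ (D : ℂ) * (1 : ℂ)) := by simp
    _ = D ^ 2 * dps W G (fun _ ↦ (1 : ℂ)) := dps_const_mul W G D _

/-! ## §2. Hölder: eq. (6.3) -/

/-- **Eq. (6.3), the Hölder step**: for `k ≥ 1`,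
`dps W F a = ∑_{t,t'} |P(t−t')|² ≤ |W|^{2−2/k} (∑_{t,t'} |P(t−t')^k|²)^{1/k}` (the power-mean
inequality on the `|W|²` pairs). [cite: GuthMaynard2026, Section 6, (6.3)] -/
theorem dps_le_of_pow (W : Finset ℝ) (F : Finset ℕ) (a : ℕ → ℂ) {k : ℕ} (hk : 1 ≤ k) :
    dps W F a ≤ (W.card : ℝ) ^ (2 - 2 / (k : ℝ)) *
      (∑ t ∈ W, ∑ t' ∈ W, ‖(∑ n ∈ F, a n * twist n (t - t')) ^ k‖ ^ 2) ^ (1 / (k : ℝ)) := by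
  classical
  set R : ℝ := (W.card : ℝ) with hR
  have hk0 : (0 : ℝ) < k := by exact_mod_cast hk
  have hkne : (k : ℝ) ≠ 0 := hk0.ne'
  set z : ℝ × ℝ → ℝ := fun p ↦ ‖∑ n ∈ F, a n * twist n (p.1 - p.2)‖ ^ 2 with hz
  have hz0 : ∀ p, 0 ≤ z p := fun p ↦ by positivity
  have hdps : dps W F a = ∑ p ∈ W ×ˢ W, z p := by
    unfold dps; rw [Finset.sum_product]
  set Y : ℝ := ∑ t ∈ W, ∑ t' ∈ W, ‖(∑ n ∈ F, a n * twist n (t - t')) ^ k‖ ^ 2 with hY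
  have hYz : Y = ∑ p ∈ W ×ˢ W, z p ^ k := by
    rw [hY, Finset.sum_product]
    refine Finset.sum_congr rfl fun t _ ↦ Finset.sum_congr rfl fun t' _ ↦ ?_
    rw [hz, norm_pow]; ring
  have hY0 : 0 ≤ Y := by rw [hY]; positivity
  rcases Nat.eq_zero_or_pos W.card with hW0 | hWpos
  · -- empty `W`
    have hWe : W = ∅ := Finset.card_eq_zero.mp hW0
    have : dps W F a = 0 := by rw [hdps, hWe]; simp
    rw [this]
    positivity
  have hR0 : 0 < R := by rw [hR]; exact_mod_cast hWpos
  have hR2 : ((W ×ˢ W).card : ℝ) = R ^ 2 := by rw [Finset.card_product, hR]; push_cast; ring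
  -- power mean with weights `1/R²`
  have hw1 : ∑ _p ∈ W ×ˢ W, (1 / R ^ 2 : ℝ) = 1 := by
    rw [Finset.sum_const, nsmul_eq_mul, hR2]
    exact mul_one_div_cancel (pow_ne_zero 2 hR0.ne')
  have hpm := Real.pow_arith_mean_le_arith_mean_pow (W ×ˢ W) (fun _ ↦ 1 / R ^ 2) z
    (fun _ _ ↦ by positivity) hw1 (fun p _ ↦ hz0 p) k
  rw [← Finset.mul_sum, ← Finset.mul_sum, ← hdps, ← hYz] at hpm
  -- `(dps/R²)^k ≤ Y/R²`, so `dps^k ≤ (R²)^{k-1} Y`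
  have hP0 : 0 ≤ dps W F a := dps_nonneg _ _ _
  have hRk : (R ^ 2) ^ k = (R ^ 2) ^ (k - 1) * R ^ 2 := by
    rw [← pow_succ, Nat.sub_add_cancel hk]
  have h1 : dps W F a ^ k ≤ (R ^ 2) ^ (k - 1) * Y := by
    have e : (1 / R ^ 2 * dps W F a) ^ k = (dps W F a) ^ k / (R ^ 2) ^ k := by
      rw [mul_pow, one_div, inv_pow]; ring
    rw [e, div_le_iff₀ (by positivity)] at hpm
    have h2 : dps W F a ^ k ≤ 1 / R ^ 2 * Y * ((R ^ 2) ^ (k - 1) * R ^ 2) := by rw [← hRk]; exact hpm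
    calc dps W F a ^ k ≤ 1 / R ^ 2 * Y * ((R ^ 2) ^ (k - 1) * R ^ 2) := h2
      _ = (R ^ 2) ^ (k - 1) * Y * (R ^ 2 * (1 / R ^ 2)) := by ring
      _ = (R ^ 2) ^ (k - 1) * Y := by rw [mul_one_div_cancel (pow_ne_zero 2 hR0.ne'), mul_one]
  -- take `k`-th roots
  have h2 : dps W F a = (dps W F a ^ k) ^ (1 / (k : ℝ)) := by
    rw [one_div, Real.pow_rpow_inv_natCast hP0 (Nat.pos_iff_ne_zero.mp hk)]
  have hRk0 : 0 ≤ (R ^ 2) ^ (k - 1) := pow_nonneg (pow_nonneg hR0.le 2) _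
  have h3 : ((R ^ 2) ^ (k - 1) * Y) ^ (1 / (k : ℝ)) = R ^ (2 - 2 / (k : ℝ)) * Y ^ (1 / (k : ℝ)) := by
    rw [Real.mul_rpow hRk0 hY0]
    congr 1
    rw [← pow_mul, pow_rpow_eq hR0.le]
    congr 1
    rw [Nat.cast_mul, Nat.cast_sub hk]
    push_cast
    field_simp
    try ring
  rw [h2]
  calc (dps W F a ^ k) ^ (1 / (k : ℝ)) ≤ ((R ^ 2) ^ (k - 1) * Y) ^ (1 / (k : ℝ)) :=
        Real.rpow_le_rpow (pow_nonneg hP0 k) h1 (by rw [one_div]; exact inv_nonneg.mpr hk0.le)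
    _ = R ^ (2 - 2 / (k : ℝ)) * Y ^ (1 / (k : ℝ)) := h3

/-! ## §3. Heath-Brown's theorem on the `k`-adic range `(2^{kb}, 2^{kb+k}]`: eq. (6.4) -/

/-- Membership in the `i`-th dyadic piece `{m : ⌊log₂(m−1)⌋ = i}` of a range: `2^i < m ≤ 2^{i+1}`.
[folklore] -/
private theorem mem_dyadic_piece {A B i m : ℕ} (hm : m ∈ (Finset.Ioc A B).filter (fun m ↦ Nat.log 2 (m - 1) = i))
    (hA : 1 ≤ A) : 2 ^ i + 1 ≤ m ∧ m ≤ 2 ^ (i + 1) := by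
  rw [Finset.mem_filter, Finset.mem_Ioc] at hm
  obtain ⟨⟨h1, -⟩, h3⟩ := hm
  have h4 : 2 ^ i ≤ m - 1 := by rw [← h3]; exact Nat.pow_log_le_self 2 (by omega)
  have h5 : m - 1 < 2 ^ (i + 1) := by rw [← h3]; exact Nat.lt_pow_succ_log_self one_lt_two (m - 1)
  omega

set_option maxHeartbeats 1000000 in
/-- **Eq. (6.4): Heath-Brown's theorem on the range `(2^{kb}, 2^{kb+k}]`** (the `k` dyadic pieces
`(2^i, 2^{i+1}]`, `kb ≤ i < kb+k`, each of length `≤ 2^{k-1}M^k` when `2^b ≤ M`): with Heath-Brown's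
theorem for the given `T` in the form `hCh`,
`dps W (2^{kb}, 2^{kb+k}] 1 ≤ k² 4^k C_h T^{ε'} (|W|²M^k + |W|M^{2k} + |W|^{5/4}T^{1/2}M^k)`.
[cite: GuthMaynard2026, Section 6, (6.4)] -/
theorem dps_kadic_range_le {Ch ε' : ℝ} (hCh0 : 0 ≤ Ch) {T : ℝ} (hT0 : 0 ≤ T) (W : Finset ℝ)
    (hCh : ∀ (L : ℕ), 1 ≤ L →
      dps W (Finset.Ioc L (2 * L)) (fun _ ↦ (1 : ℂ)) ≤
        Ch * T ^ ε' * ((W.card : ℝ) ^ 2 * L + (W.card : ℝ) * (L : ℝ) ^ 2 +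
          (W.card : ℝ) ^ (5 / 4 : ℝ) * T ^ (1 / 2 : ℝ) * L))
    {M b k : ℕ} (hk : 1 ≤ k) (h2b : (2 : ℝ) ^ b ≤ M) :
    dps W (Finset.Ioc (2 ^ (k * b)) (2 ^ (k * b + k))) (fun _ ↦ (1 : ℂ)) ≤
      (k : ℝ) ^ 2 * 4 ^ k * Ch * T ^ ε' * ((W.card : ℝ) ^ 2 * (M : ℝ) ^ k +
        (W.card : ℝ) * (M : ℝ) ^ (2 * k) + (W.card : ℝ) ^ (5 / 4 : ℝ) * T ^ (1 / 2 : ℝ) * (M : ℝ) ^ k) := by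
  classical
  set R : ℝ := (W.card : ℝ) with hR
  have hR0 : 0 ≤ R := Nat.cast_nonneg _
  have hM0 : (0 : ℝ) ≤ M := Nat.cast_nonneg _
  set G : Finset ℕ := Finset.Ioc (2 ^ (k * b)) (2 ^ (k * b + k)) with hG
  set S : Finset ℕ := Finset.Ico (k * b) (k * b + k) with hS
  have hA1 : 1 ≤ 2 ^ (k * b) := Nat.one_le_two_pow
  -- every element of the range lies in one of the `k` dyadic pieces
  have hpart : ∀ m ∈ G, Nat.log 2 (m - 1) ∈ S := by
    intro m hm
    rw [hG, Finset.mem_Ioc] at hm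
    rw [hS, Finset.mem_Ico]
    constructor
    · -- `2^{kb} ≤ m - 1`
      have : 2 ^ (k * b) ≤ m - 1 := by omega
      calc k * b = Nat.log 2 (2 ^ (k * b)) := (Nat.log_pow one_lt_two _).symm
        _ ≤ Nat.log 2 (m - 1) := Nat.log_mono_right this
    · -- `m - 1 < 2^{kb+k}`
      have : m - 1 < 2 ^ (k * b + k) := by omega
      exact Nat.log_lt_of_lt_pow (by omega) this
  have hsplit := dps_le_card_mul_sum_filter W G (fun _ ↦ (1 : ℂ)) S (fun m ↦ Nat.log 2 (m - 1)) hpart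
  have hScard : (S.card : ℝ) = k := by rw [hS, Nat.card_Ico, show k * b + k - k * b = k by omega]
  -- the size of each piece: `2^i ≤ 2^{kb+k-1} ≤ 2^{k-1} M^k`
  have hMk : (2 : ℝ) ^ (k * b) ≤ (M : ℝ) ^ k := by
    rw [pow_mul', ]
    exact pow_le_pow_left₀ (by positivity) h2b k
  set X : ℝ := R ^ 2 * (M : ℝ) ^ k + R * (M : ℝ) ^ (2 * k) + R ^ (5 / 4 : ℝ) * T ^ (1 / 2 : ℝ) * (M : ℝ) ^ k
    with hX
  have hX0 : 0 ≤ X := by positivity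
  have hpiece : ∀ i ∈ S, dps W (G.filter (fun m ↦ Nat.log 2 (m - 1) = i)) (fun _ ↦ (1 : ℂ)) ≤
      Ch * T ^ ε' * (4 ^ k * X) := by
    intro i hi
    rw [hS, Finset.mem_Ico] at hi
    set L : ℕ := 2 ^ i with hL
    have hL1 : 1 ≤ L := Nat.one_le_two_pow
    -- the piece is contained in `(L, 2L]`
    have hsub : G.filter (fun m ↦ Nat.log 2 (m - 1) = i) ⊆ Finset.Ioc L (2 * L) := by
      intro m hm
      obtain ⟨h1, h2⟩ := mem_dyadic_piece hm hA1
      rw [Finset.mem_Ioc, hL]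
      constructor
      · omega
      · rw [pow_succ] at h2; omega
    have hmono : dps W (G.filter (fun m ↦ Nat.log 2 (m - 1) = i)) (fun _ ↦ (1 : ℂ)) ≤
        dps W (Finset.Ioc L (2 * L)) (fun _ ↦ (1 : ℂ)) := by
      have h := dps_mono W hsub (by rw [Finset.mem_Ioc]; omega) (b := fun _ ↦ (1 : ℝ)) (fun _ _ ↦ zero_le_one)
      simpa using h
    refine hmono.trans ((hCh L hL1).trans ?_)
    -- `L ≤ 2^{k-1} M^k`, `L² ≤ 4^{k-1} M^{2k}`
    have hLle : (L : ℝ) ≤ 2 ^ (k - 1) * (M : ℝ) ^ k := by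
      have h1 : i ≤ k * b + (k - 1) := by omega
      calc (L : ℝ) = (2 : ℝ) ^ i := by rw [hL]; push_cast; ring
        _ ≤ (2 : ℝ) ^ (k * b + (k - 1)) := pow_le_pow_right₀ one_le_two h1
        _ = 2 ^ (k - 1) * (2 : ℝ) ^ (k * b) := by rw [pow_add]; ring
        _ ≤ 2 ^ (k - 1) * (M : ℝ) ^ k := mul_le_mul_of_nonneg_left hMk (by positivity)
    have h2k1 : (2 : ℝ) ^ (k - 1) ≤ 4 ^ k := by
      calc (2 : ℝ) ^ (k - 1) ≤ 2 ^ k := pow_le_pow_right₀ one_le_two (Nat.sub_le k 1)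
        _ ≤ 4 ^ k := pow_le_pow_left₀ (by norm_num) (by norm_num) k
    have h4k1 : ((2 : ℝ) ^ (k - 1)) ^ 2 ≤ 4 ^ k := by
      calc ((2 : ℝ) ^ (k - 1)) ^ 2 = 4 ^ (k - 1) := by rw [← pow_mul, mul_comm, pow_mul]; norm_num
        _ ≤ 4 ^ k := pow_le_pow_right₀ (by norm_num) (Nat.sub_le k 1)
    have hL0 : (0 : ℝ) ≤ L := Nat.cast_nonneg _
    have hLk : (L : ℝ) ≤ 4 ^ k * (M : ℝ) ^ k :=
      hLle.trans (mul_le_mul_of_nonneg_right h2k1 (by positivity))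
    have hL2 : (L : ℝ) ^ 2 ≤ 4 ^ k * (M : ℝ) ^ (2 * k) := by
      calc (L : ℝ) ^ 2 ≤ (2 ^ (k - 1) * (M : ℝ) ^ k) ^ 2 := pow_le_pow_left₀ hL0 hLle 2
        _ = ((2 : ℝ) ^ (k - 1)) ^ 2 * (M : ℝ) ^ (2 * k) := by rw [mul_pow, ← pow_mul (M : ℝ) k 2, mul_comm k 2]
        _ ≤ 4 ^ k * (M : ℝ) ^ (2 * k) := mul_le_mul_of_nonneg_right h4k1 (by positivity)
    have hC0 : 0 ≤ Ch * T ^ ε' := by positivity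
    calc Ch * T ^ ε' * (R ^ 2 * L + R * (L : ℝ) ^ 2 + R ^ (5 / 4 : ℝ) * T ^ (1 / 2 : ℝ) * L)
        ≤ Ch * T ^ ε' * (R ^ 2 * (4 ^ k * (M : ℝ) ^ k) + R * (4 ^ k * (M : ℝ) ^ (2 * k)) +
          R ^ (5 / 4 : ℝ) * T ^ (1 / 2 : ℝ) * (4 ^ k * (M : ℝ) ^ k)) := by gcongr
      _ = Ch * T ^ ε' * (4 ^ k * X) := by rw [hX]; ring
  have hsum : ∑ i ∈ S, dps W (G.filter (fun m ↦ Nat.log 2 (m - 1) = i)) (fun _ ↦ (1 : ℂ)) ≤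
      (k : ℝ) * (Ch * T ^ ε' * (4 ^ k * X)) := by
    refine (Finset.sum_le_sum hpiece).trans (le_of_eq ?_)
    rw [Finset.sum_const, nsmul_eq_mul, hScard]
  calc dps W G (fun _ ↦ (1 : ℂ)) ≤ (S.card : ℝ) * ∑ i ∈ S, dps W (G.filter (fun m ↦ Nat.log 2 (m - 1) = i)) (fun _ ↦ (1 : ℂ)) :=
        hsplit
    _ ≤ (k : ℝ) * ((k : ℝ) * (Ch * T ^ ε' * (4 ^ k * X))) := by
        rw [hScard]; exact mul_le_mul_of_nonneg_left hsum (Nat.cast_nonneg k)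
    _ = (k : ℝ) ^ 2 * 4 ^ k * Ch * T ^ ε' * X := by ring

/-- `(x+y+z)^{q} ≤ x^q + y^q + z^q` for `x, y, z ≥ 0`, `0 ≤ q ≤ 1`. [folklore] -/
private theorem rpow_le_three {x y z q : ℝ} (hx : 0 ≤ x) (hy : 0 ≤ y) (hz : 0 ≤ z) (hq : 0 ≤ q) (hq1 : q ≤ 1) :
    (x + y + z) ^ q ≤ x ^ q + y ^ q + z ^ q := by
  calc (x + y + z) ^ q ≤ (x + y) ^ q + z ^ q := Real.rpow_add_le_add_rpow (by positivity) hz hq hq1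
    _ ≤ (x ^ q + y ^ q) + z ^ q := by gcongr; exact Real.rpow_add_le_add_rpow hx hy hq hq1

/-! ## §4. One dyadic block in `m`, and the sum over blocks: eqs. (6.3)–(6.5) for general `k` -/

set_option maxHeartbeats 1600000 in
/-- **One dyadic block in `m`, general `k`**: for `F_b = {m ∈ (1, M] : ⌊log₂(m−1)⌋ = b}` (`2^b ≤ M`),
unimodular `a`, the divisor bound `d(n) ≤ C_d n^η`, `k ≥ 1`, and Heath-Brown's theorem for `T` in the
form `hCh`:
`dps W F_b a ≤ |W|^{2−2/k} · ((C_d 2^{kη} M^{kη})^k)^{2/k} · (k² 4^k C_h T^{ε'})^{1/k} ·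
(|W|^{2/k} M + |W|^{1/k} M² + |W|^{5/(4k)} T^{1/(2k)} M)`.
[cite: GuthMaynard2026, Section 6, (6.3)–(6.5)] -/
theorem dps_block_le_k {Ch ε' Cd η : ℝ} (hCh0 : 0 ≤ Ch) (hCd0 : 0 ≤ Cd) (hη : 0 < η)
    (hCd : ∀ n : ℕ, (n.divisors.card : ℝ) ≤ Cd * (n : ℝ) ^ η) {T : ℝ} (hT0 : 0 ≤ T) (W : Finset ℝ)
    (hCh : ∀ (L : ℕ), 1 ≤ L →
      dps W (Finset.Ioc L (2 * L)) (fun _ ↦ (1 : ℂ)) ≤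
        Ch * T ^ ε' * ((W.card : ℝ) ^ 2 * L + (W.card : ℝ) * (L : ℝ) ^ 2 +
          (W.card : ℝ) ^ (5 / 4 : ℝ) * T ^ (1 / 2 : ℝ) * L))
    {k : ℕ} (hk : 1 ≤ k) {M b : ℕ} (hM : 1 ≤ M) (h2b : (2 : ℝ) ^ b ≤ M)
    {a : ℕ → ℂ} (ha : ∀ m : ℕ, 1 ≤ m → ‖a m‖ ≤ 1) :
    dps W ((Finset.Ioc 1 M).filter (fun m ↦ Nat.log 2 (m - 1) = b)) a ≤
      (W.card : ℝ) ^ (2 - 2 / (k : ℝ)) *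
        (((Cd * (2 : ℝ) ^ ((k : ℝ) * η) * (M : ℝ) ^ ((k : ℝ) * η)) ^ k) ^ 2) ^ (1 / (k : ℝ)) *
        (((k : ℝ) ^ 2 * 4 ^ k * Ch * T ^ ε') ^ (1 / (k : ℝ)) *
          ((W.card : ℝ) ^ (2 / (k : ℝ)) * M + (W.card : ℝ) ^ (1 / (k : ℝ)) * (M : ℝ) ^ 2 +
            (W.card : ℝ) ^ (5 / (4 * (k : ℝ))) * T ^ (1 / (2 * (k : ℝ))) * M)) := by
  classical
  set R : ℝ := (W.card : ℝ) with hR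
  have hR0 : 0 ≤ R := Nat.cast_nonneg _
  have hM0 : (0 : ℝ) < M := by exact_mod_cast hM
  have hk0 : (0 : ℝ) < k := by exact_mod_cast hk
  have hq0 : (0 : ℝ) ≤ 1 / (k : ℝ) := by positivity
  have hq1 : 1 / (k : ℝ) ≤ 1 := by rw [div_le_one hk0]; exact_mod_cast hk
  set F := (Finset.Ioc 1 M).filter (fun m ↦ Nat.log 2 (m - 1) = b) with hF
  set G : Finset ℕ := Finset.Ioc (2 ^ (k * b)) (2 ^ (k * b + k)) with hG
  have hG0 : 0 ∉ G := by simp [hG]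
  have haF : ∀ n ∈ F, ‖a n‖ ≤ 1 := fun n hn ↦ ha n (by have := (mem_block hn).1; omega)
  -- every `k`-fold product of elements of `F` lies in `G`
  have hFG : ∀ f ∈ Fintype.piFinset (fun _ : Fin k ↦ F), (∏ i, f i) ∈ G := by
    intro f hf
    rw [Fintype.mem_piFinset] at hf
    have hlo : ∀ i, 2 ^ b + 1 ≤ f i := fun i ↦ (mem_block (hf i)).2.2.1
    have hhi : ∀ i, f i ≤ 2 ^ (b + 1) := fun i ↦ (mem_block (hf i)).2.2.2
    rw [hG, Finset.mem_Ioc]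
    constructor
    · -- `2^{kb} < ∏ f`: `∏ f ≥ (2^b+1)^k > 2^{kb}`
      have h1 : (2 ^ b + 1) ^ k ≤ ∏ i, f i := by
        calc (2 ^ b + 1) ^ k = ∏ _i : Fin k, (2 ^ b + 1) := (Fin.prod_const k _).symm
          _ ≤ ∏ i, f i := Finset.prod_le_prod' fun i _ ↦ hlo i
      have h2 : 2 ^ (k * b) < (2 ^ b + 1) ^ k := by
        rw [pow_mul']
        exact Nat.pow_lt_pow_left (Nat.lt_succ_self _) (by omega)
      exact h2.trans_le h1
    · calc ∏ i, f i ≤ ∏ _i : Fin k, 2 ^ (b + 1) := Finset.prod_le_prod' fun i _ ↦ hhi i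
        _ = 2 ^ (k * b + k) := by rw [Fin.prod_const, ← pow_mul]; ring_nf
  -- representation numbers on `G`: `≤ d(g)^k ≤ (Cd (2^{k} M^{k})^η)^k`
  set D : ℝ := (Cd * (2 : ℝ) ^ ((k : ℝ) * η) * (M : ℝ) ^ ((k : ℝ) * η)) ^ k with hD
  have hD0 : 0 ≤ D := by positivity
  have hGle : ∀ g ∈ G, (g : ℝ) ≤ (2 : ℝ) ^ k * (M : ℝ) ^ k := by
    intro g hg
    rw [hG, Finset.mem_Ioc] at hg
    calc (g : ℝ) ≤ ((2 ^ (k * b + k) : ℕ) : ℝ) := by exact_mod_cast hg.2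
      _ = (2 : ℝ) ^ k * (2 : ℝ) ^ (k * b) := by push_cast; rw [pow_add]; ring
      _ ≤ (2 : ℝ) ^ k * (M : ℝ) ^ k := by
          refine mul_le_mul_of_nonneg_left ?_ (by positivity)
          rw [pow_mul']; exact pow_le_pow_left₀ (by positivity) h2b k
  have hdg : ∀ g ∈ G, (g.divisors.card : ℝ) ≤ Cd * (2 : ℝ) ^ ((k : ℝ) * η) * (M : ℝ) ^ ((k : ℝ) * η) := by
    intro g hg
    refine (hCd g).trans ?_
    rw [mul_assoc]
    refine mul_le_mul_of_nonneg_left ?_ hCd0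
    calc (g : ℝ) ^ η ≤ ((2 : ℝ) ^ k * (M : ℝ) ^ k) ^ η := Real.rpow_le_rpow (Nat.cast_nonneg g) (hGle g hg) hη.le
      _ = (2 : ℝ) ^ ((k : ℝ) * η) * (M : ℝ) ^ ((k : ℝ) * η) := by
          rw [Real.mul_rpow (by positivity) (by positivity), pow_rpow_eq (by norm_num), pow_rpow_eq hM0.le]
  have hrep : ∀ g ∈ G,
      (((Fintype.piFinset (fun _ : Fin k ↦ F)).filter (fun f ↦ ∏ i, f i = g)).card : ℝ) ≤ D := by
    intro g hg
    have hg0 : g ≠ 0 := fun h ↦ hG0 (h ▸ hg)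
    calc (((Fintype.piFinset (fun _ : Fin k ↦ F)).filter (fun f ↦ ∏ i, f i = g)).card : ℝ)
        ≤ ((g.divisors.card ^ k : ℕ) : ℝ) := by exact_mod_cast card_tuples_prod_eq_le F k hg0
      _ = (g.divisors.card : ℝ) ^ k := by push_cast; ring
      _ ≤ D := by rw [hD]; exact pow_le_pow_left₀ (Nat.cast_nonneg _) (hdg g hg) k
  -- (6.3): Hölder and the majorant principle
  set Y : ℝ := ∑ t ∈ W, ∑ t' ∈ W, ‖(∑ n ∈ F, a n * twist n (t - t')) ^ k‖ ^ 2 with hY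
  have hY0 : 0 ≤ Y := by positivity
  have h63 : dps W F a ≤ R ^ (2 - 2 / (k : ℝ)) * Y ^ (1 / (k : ℝ)) := dps_le_of_pow W F a hk
  have hYle : Y ≤ D ^ 2 * dps W G (fun _ ↦ (1 : ℂ)) := sum_norm_pow_sq_le_dps W hG0 k hFG haF hD0 hrep
  -- (6.4): Heath-Brown on `G`
  set X : ℝ := R ^ 2 * (M : ℝ) ^ k + R * (M : ℝ) ^ (2 * k) + R ^ (5 / 4 : ℝ) * T ^ (1 / 2 : ℝ) * (M : ℝ) ^ k
    with hX
  have hX0 : 0 ≤ X := by positivity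
  have h64 : dps W G (fun _ ↦ (1 : ℂ)) ≤ (k : ℝ) ^ 2 * 4 ^ k * Ch * T ^ ε' * X :=
    dps_kadic_range_le hCh0 hT0 W hCh hk h2b
  have hQ0 : 0 ≤ dps W G (fun _ ↦ (1 : ℂ)) := dps_nonneg _ _ _
  -- the `k`-th root of `X`
  have hXroot : X ^ (1 / (k : ℝ)) ≤ R ^ (2 / (k : ℝ)) * M + R ^ (1 / (k : ℝ)) * (M : ℝ) ^ 2 +
      R ^ (5 / (4 * (k : ℝ))) * T ^ (1 / (2 * (k : ℝ))) * M := by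
    have hkk : ((k : ℕ) : ℝ) * (1 / (k : ℝ)) = 1 := by field_simp
    have e1 : (R ^ 2 * (M : ℝ) ^ k) ^ (1 / (k : ℝ)) = R ^ (2 / (k : ℝ)) * M := by
      rw [Real.mul_rpow (by positivity) (by positivity), pow_rpow_eq hR0, pow_rpow_eq hM0.le, hkk,
        Real.rpow_one]
      congr 1
      congr 1
      push_cast
      field_simp
    have e2 : (R * (M : ℝ) ^ (2 * k)) ^ (1 / (k : ℝ)) = R ^ (1 / (k : ℝ)) * (M : ℝ) ^ 2 := by
      rw [Real.mul_rpow hR0 (by positivity), pow_rpow_eq hM0.le]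
      congr 1
      rw [show ((2 * k : ℕ) : ℝ) * (1 / (k : ℝ)) = ((2 : ℕ) : ℝ) by push_cast; field_simp, Real.rpow_natCast]
    have e3 : (R ^ (5 / 4 : ℝ) * T ^ (1 / 2 : ℝ) * (M : ℝ) ^ k) ^ (1 / (k : ℝ)) =
        R ^ (5 / (4 * (k : ℝ))) * T ^ (1 / (2 * (k : ℝ))) * M := by
      rw [Real.mul_rpow (by positivity) (by positivity), Real.mul_rpow (by positivity) (by positivity),
        ← Real.rpow_mul hR0, ← Real.rpow_mul hT0, pow_rpow_eq hM0.le, hkk, Real.rpow_one]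
      congr 2
      · congr 1; field_simp
      · congr 1; field_simp
    calc X ^ (1 / (k : ℝ)) ≤ (R ^ 2 * (M : ℝ) ^ k) ^ (1 / (k : ℝ)) + (R * (M : ℝ) ^ (2 * k)) ^ (1 / (k : ℝ)) +
        (R ^ (5 / 4 : ℝ) * T ^ (1 / 2 : ℝ) * (M : ℝ) ^ k) ^ (1 / (k : ℝ)) :=
          rpow_le_three (by positivity) (by positivity) (by positivity) hq0 hq1
      _ = _ := by rw [e1, e2, e3]
  -- assemble
  have hYk : Y ^ (1 / (k : ℝ)) ≤ (D ^ 2) ^ (1 / (k : ℝ)) * ((((k : ℝ) ^ 2 * 4 ^ k * Ch * T ^ ε') ^ (1 / (k : ℝ))) *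
      (R ^ (2 / (k : ℝ)) * M + R ^ (1 / (k : ℝ)) * (M : ℝ) ^ 2 +
        R ^ (5 / (4 * (k : ℝ))) * T ^ (1 / (2 * (k : ℝ))) * M)) := by
    calc Y ^ (1 / (k : ℝ)) ≤ (D ^ 2 * dps W G (fun _ ↦ (1 : ℂ))) ^ (1 / (k : ℝ)) :=
          Real.rpow_le_rpow hY0 hYle hq0
      _ = (D ^ 2) ^ (1 / (k : ℝ)) * (dps W G (fun _ ↦ (1 : ℂ))) ^ (1 / (k : ℝ)) :=
          Real.mul_rpow (by positivity) hQ0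
      _ ≤ (D ^ 2) ^ (1 / (k : ℝ)) * (((k : ℝ) ^ 2 * 4 ^ k * Ch * T ^ ε' * X) ^ (1 / (k : ℝ))) := by
          gcongr
      _ = (D ^ 2) ^ (1 / (k : ℝ)) * ((((k : ℝ) ^ 2 * 4 ^ k * Ch * T ^ ε') ^ (1 / (k : ℝ))) * X ^ (1 / (k : ℝ))) := by
          rw [Real.mul_rpow (by positivity) hX0]
      _ ≤ _ := by gcongr
  calc dps W F a ≤ R ^ (2 - 2 / (k : ℝ)) * Y ^ (1 / (k : ℝ)) := h63
    _ ≤ R ^ (2 - 2 / (k : ℝ)) * ((D ^ 2) ^ (1 / (k : ℝ)) * ((((k : ℝ) ^ 2 * 4 ^ k * Ch * T ^ ε') ^ (1 / (k : ℝ))) *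
      (R ^ (2 / (k : ℝ)) * M + R ^ (1 / (k : ℝ)) * (M : ℝ) ^ 2 +
        R ^ (5 / (4 * (k : ℝ))) * T ^ (1 / (2 * (k : ℝ))) * M))) :=
        mul_le_mul_of_nonneg_left hYk (by positivity)
    _ = _ := by rw [hD]; ring

set_option maxHeartbeats 1600000 in
/-- **Eqs. (6.3)–(6.5) of Guth–Maynard for a general exponent `k ≥ 1`.** For every `k ≥ 1` and
`ε > 0` there are `C, T₀` such that for `T ≥ T₀`, `1 ≤ M ≤ T`, every finite `1`-separated `W` in an
interval of length `T` and every real `ξ`,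
`∑_{t,t'∈W} |D_M(t−t'+2πξ)|² ≤ C T^ε (M|W|² + M²|W|^{2−1/k} + M T^{1/(2k)}|W|^{2−3/(4k)})`
(the element `m = 1` apart, dyadic blocks `(2^b, 2^{b+1}]` in `m`, Hölder with exponent `k`
(`dps_le_of_pow`), the divisor bound for the coefficients of the `k`-th power
(`sum_norm_pow_sq_le_dps`, `card_tuples_prod_eq_le`), and Heath-Brown's theorem on the `k` dyadic
ranges covering `(2^{kb}, 2^{kb+k}]` (`dps_kadic_range_le`)); for `k = 4` this is the tree's
`GuthMaynardS2.sum_sq_norm_dirD_le`. [cite: GuthMaynard2026, Section 6, (6.3)–(6.5)] -/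
theorem sum_sq_norm_dirD_le_k {k : ℕ} (hk : 1 ≤ k) {ε : ℝ} (hε : 0 < ε) :
    ∃ C T₀ : ℝ, 0 ≤ C ∧ ∀ (T : ℝ), T₀ ≤ T →
      ∀ (M : ℕ), 1 ≤ M → (M : ℝ) ≤ T → ∀ (W : Finset ℝ) (T₁ : ℝ), (∀ t ∈ W, T₁ ≤ t ∧ t ≤ T₁ + T) →
      (∀ t ∈ W, ∀ t' ∈ W, t ≠ t' → 1 ≤ |t - t'|) → ∀ ξ : ℝ,
      ∑ t ∈ W, ∑ t' ∈ W, ‖dirD M (t - t' + 2 * π * ξ)‖ ^ 2 ≤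
        C * T ^ ε * ((M : ℝ) * (W.card : ℝ) ^ 2 + (M : ℝ) ^ 2 * (W.card : ℝ) ^ (2 - 1 / (k : ℝ)) +
          (M : ℝ) * T ^ (1 / (2 * (k : ℝ))) * (W.card : ℝ) ^ (2 - 3 / (4 * (k : ℝ)))) := by
  classical
  have hk0 : (0 : ℝ) < k := by exact_mod_cast hk
  have hkne : (k : ℝ) ≠ 0 := hk0.ne'
  have hk1 : (1 : ℝ) ≤ k := by exact_mod_cast hk
  -- parameters: `η = ε/(4(k+1))` for the divisor bound and the number of blocks, `ε/2` for Heath-Brown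
  set η : ℝ := ε / (4 * ((k : ℝ) + 1)) with hη
  have hη0 : 0 < η := by positivity
  obtain ⟨Cd, hCd1, hCd⟩ := Literature.NumberTheory.Sieve.exists_card_divisors_le_mul_rpow' hη0
  obtain ⟨T₀, hT₀⟩ := HeathBrownDZS.heathBrown_differenceSet (half_pos hε)
  have hCd0 : 0 ≤ Cd := by linarith
  set Cη : ℝ := 1 / (η * Real.log 2) + 1 with hCη
  have hCη0 : 0 ≤ Cη := by positivity
  set K₀ : ℝ := (Cd * (2 : ℝ) ^ ((k : ℝ) * η)) ^ 2 * (((k : ℝ) ^ 2 * 4 ^ k * 2) ^ (1 / (k : ℝ))) with hK₀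
  have hK₀0 : 0 ≤ K₀ := by positivity
  refine ⟨Cη ^ 2 * K₀ * 2 + 2, max T₀ 2, by positivity, fun T hT M hM hMT1 W T₁ hwin hsep ξ ↦ ?_⟩
  have hTT₀ : T₀ ≤ T := le_trans (le_max_left _ _) hT
  have hT2 : 2 ≤ T := le_trans (le_max_right _ _) hT
  have hT0 : 0 < T := by linarith
  have hT1 : (1 : ℝ) ≤ T := by linarith
  have hM0 : (0 : ℝ) < M := by exact_mod_cast hM
  have hM1 : (1 : ℝ) ≤ M := by exact_mod_cast hM
  set R : ℝ := (W.card : ℝ) with hR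
  have hR0 : 0 ≤ R := Nat.cast_nonneg _
  -- Heath-Brown for this `W`, coefficients `1`
  have hCh : ∀ (L : ℕ), 1 ≤ L → dps W (Finset.Ioc L (2 * L)) (fun _ ↦ (1 : ℂ)) ≤
      2 * T ^ (ε / 2) * (R ^ 2 * L + R * (L : ℝ) ^ 2 + R ^ (5 / 4 : ℝ) * T ^ (1 / 2 : ℝ) * L) := by
    intro L hL
    have h := hT₀ T hTT₀ W T₁ hwin hsep L hL (fun _ ↦ (1 : ℂ)) (fun _ ↦ by simp)
    exact h
  -- Step 1: the sum is a double zeta sum with unimodular coefficients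
  set a : ℕ → ℂ := fun m ↦ ePow (-(((2 * π * ξ : ℝ) : ℂ) * I)) m with ha
  have ha1 : ∀ m : ℕ, 1 ≤ m → ‖a m‖ ≤ 1 := fun m hm ↦ (norm_ePow_coeff hm ξ).le
  have hdps : ∑ t ∈ W, ∑ t' ∈ W, ‖dirD M (t - t' + 2 * π * ξ)‖ ^ 2 = dps W (Finset.Icc 1 M) a := by
    rw [dps_eq_swap]
    refine Finset.sum_congr rfl fun t _ ↦ Finset.sum_congr rfl fun t' _ ↦ ?_
    rw [dirD_sub_add]
    rfl
  rw [hdps]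
  -- Step 2: split off `m = 1` and cut `(1, M]` into dyadic blocks
  have hsplit : Finset.Icc 1 M = {1} ∪ Finset.Ioc 1 M := by
    ext m; simp only [Finset.mem_union, Finset.mem_singleton, Finset.mem_Icc, Finset.mem_Ioc]; omega
  have hdisj : Disjoint ({1} : Finset ℕ) (Finset.Ioc 1 M) := by
    rw [Finset.disjoint_singleton_left, Finset.mem_Ioc]; omega
  have hone : dps W ({1} : Finset ℕ) a ≤ R ^ 2 := by
    unfold dps
    have : ∀ t ∈ W, ∀ t' ∈ W, ‖∑ n ∈ ({1} : Finset ℕ), a n * twist n (t - t')‖ ^ 2 ≤ 1 := by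
      intro t _ t' _
      rw [Finset.sum_singleton, norm_mul]
      have h1 : ‖a 1‖ ≤ 1 := ha1 1 le_rfl
      have h2 : ‖twist 1 (t - t')‖ ≤ 1 := norm_twist_le 1 _
      exact pow_le_one₀ (by positivity) (mul_le_one₀ h1 (norm_nonneg _) h2)
    calc ∑ t ∈ W, ∑ t' ∈ W, ‖∑ n ∈ ({1} : Finset ℕ), a n * twist n (t - t')‖ ^ 2
        ≤ ∑ t ∈ W, ∑ t' ∈ W, (1 : ℝ) := Finset.sum_le_sum fun t ht ↦ Finset.sum_le_sum fun t' ht' ↦ this t ht t' ht'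
      _ = R ^ 2 := by simp [hR]; ring
  set B : ℕ := Nat.log 2 M with hB
  set S : Finset ℕ := Finset.range (B + 1) with hS
  have hpart : ∀ m ∈ Finset.Ioc 1 M, Nat.log 2 (m - 1) ∈ S := by
    intro m hm
    rw [Finset.mem_Ioc] at hm
    rw [hS, Finset.mem_range]
    exact Nat.lt_succ_of_le (Nat.log_mono_right (by omega))
  have hblocks := dps_le_card_mul_sum_filter W (Finset.Ioc 1 M) a S (fun m ↦ Nat.log 2 (m - 1)) hpart
  have hScard : (S.card : ℝ) = B + 1 := by rw [hS, Finset.card_range]; push_cast; ring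
  have hB1 : (B : ℝ) + 1 ≤ Cη * (M : ℝ) ^ η := natLog_add_one_le hη0 hM
  have h2B : (2 : ℝ) ^ B ≤ M := by exact_mod_cast Nat.pow_log_le_self 2 (by omega : M ≠ 0)
  -- Step 3: each block
  set Mη : ℝ := (M : ℝ) ^ ((k : ℝ) * η) with hMη
  have hMη0 : 0 ≤ Mη := by positivity
  set Lin : ℝ := R ^ (2 / (k : ℝ)) * M + R ^ (1 / (k : ℝ)) * (M : ℝ) ^ 2 +
    R ^ (5 / (4 * (k : ℝ))) * T ^ (1 / (2 * (k : ℝ))) * M with hLin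
  have hLin0 : 0 ≤ Lin := by positivity
  have hDpow : (((Cd * (2 : ℝ) ^ ((k : ℝ) * η) * (M : ℝ) ^ ((k : ℝ) * η)) ^ k) ^ 2) ^ (1 / (k : ℝ)) =
      (Cd * (2 : ℝ) ^ ((k : ℝ) * η)) ^ 2 * Mη ^ 2 := by
    have hx0 : 0 ≤ Cd * (2 : ℝ) ^ ((k : ℝ) * η) * (M : ℝ) ^ ((k : ℝ) * η) := by positivity
    rw [← pow_mul, mul_comm k 2, pow_mul, one_div, Real.pow_rpow_inv_natCast (by positivity)
      (Nat.pos_iff_ne_zero.mp hk), hMη]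
    ring
  have hCpow : (((k : ℝ) ^ 2 * 4 ^ k * 2 * T ^ (ε / 2))) ^ (1 / (k : ℝ)) =
      ((k : ℝ) ^ 2 * 4 ^ k * 2) ^ (1 / (k : ℝ)) * T ^ (ε / (2 * (k : ℝ))) := by
    rw [Real.mul_rpow (by positivity) (by positivity), ← Real.rpow_mul hT0.le]
    congr 2
    field_simp
  have hblock : ∀ b ∈ S, dps W ((Finset.Ioc 1 M).filter (fun m ↦ Nat.log 2 (m - 1) = b)) a ≤
      R ^ (2 - 2 / (k : ℝ)) * (K₀ * (Mη ^ 2 * T ^ (ε / (2 * (k : ℝ))))) * Lin := by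
    intro b hb
    rw [hS, Finset.mem_range] at hb
    have h2b : (2 : ℝ) ^ b ≤ M := le_trans (pow_le_pow_right₀ one_le_two (Nat.lt_succ_iff.mp hb)) h2B
    have h := dps_block_le_k (Ch := 2) (ε' := ε / 2) zero_le_two hCd0 hη0 hCd hT0.le W hCh hk hM h2b ha1
      (b := b)
    refine h.trans (le_of_eq ?_)
    rw [hDpow, show (k : ℝ) ^ 2 * 4 ^ k * 2 * T ^ (ε / 2) = (k : ℝ) ^ 2 * 4 ^ k * 2 * T ^ (ε / 2) by ring,
      hCpow, hK₀, hLin]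
    ring
  -- Step 4: sum over the blocks
  have hsumb : ∑ b ∈ S, dps W ((Finset.Ioc 1 M).filter (fun m ↦ Nat.log 2 (m - 1) = b)) a ≤
      (B + 1 : ℝ) * (R ^ (2 - 2 / (k : ℝ)) * (K₀ * (Mη ^ 2 * T ^ (ε / (2 * (k : ℝ))))) * Lin) := by
    refine (Finset.sum_le_sum hblock).trans (le_of_eq ?_)
    rw [Finset.sum_const, nsmul_eq_mul, hScard]
  have hIoc : dps W (Finset.Ioc 1 M) a ≤ ((B : ℝ) + 1) * (((B : ℝ) + 1) *
      (R ^ (2 - 2 / (k : ℝ)) * (K₀ * (Mη ^ 2 * T ^ (ε / (2 * (k : ℝ))))) * Lin)) := by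
    refine hblocks.trans ?_
    rw [hScard]
    exact mul_le_mul_of_nonneg_left hsumb (by positivity)
  -- Step 5: collect the losses
  have hB2 : ((B : ℝ) + 1) * ((B : ℝ) + 1) ≤ Cη ^ 2 * (M : ℝ) ^ (2 * η) := by
    have h0 : 0 ≤ (B : ℝ) + 1 := by positivity
    calc ((B : ℝ) + 1) * ((B : ℝ) + 1) ≤ (Cη * (M : ℝ) ^ η) * (Cη * (M : ℝ) ^ η) :=
          mul_le_mul hB1 hB1 h0 (by positivity)
      _ = Cη ^ 2 * ((M : ℝ) ^ η * (M : ℝ) ^ η) := by ring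
      _ = Cη ^ 2 * (M : ℝ) ^ (2 * η) := by rw [← Real.rpow_add hM0]; ring_nf
  have hMpow : (M : ℝ) ^ (2 * η) * (Mη ^ 2 * T ^ (ε / (2 * (k : ℝ)))) ≤ T ^ ε := by
    have h1 : (M : ℝ) ^ (2 * η) ≤ T ^ (2 * η) := Real.rpow_le_rpow hM0.le hMT1 (by positivity)
    have h2 : Mη ^ 2 = (M : ℝ) ^ (2 * ((k : ℝ) * η)) := by
      rw [hMη, ← Real.rpow_natCast, ← Real.rpow_mul hM0.le]; ring_nf
    have h3 : Mη ^ 2 ≤ T ^ (2 * ((k : ℝ) * η)) := by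
      rw [h2]; exact Real.rpow_le_rpow hM0.le hMT1 (by positivity)
    have hexp : 2 * η + 2 * ((k : ℝ) * η) + ε / (2 * (k : ℝ)) ≤ ε := by
      have e1 : 2 * η + 2 * ((k : ℝ) * η) = ε / 2 := by rw [hη]; field_simp; ring
      have e2 : ε / (2 * (k : ℝ)) ≤ ε / 2 :=
        div_le_div_of_nonneg_left hε.le (by norm_num) (by nlinarith)
      linarith
    calc (M : ℝ) ^ (2 * η) * (Mη ^ 2 * T ^ (ε / (2 * (k : ℝ))))
        ≤ T ^ (2 * η) * (T ^ (2 * ((k : ℝ) * η)) * T ^ (ε / (2 * (k : ℝ)))) :=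
          mul_le_mul h1 (mul_le_mul_of_nonneg_right h3 (by positivity)) (by positivity) (by positivity)
      _ = T ^ (2 * η + 2 * ((k : ℝ) * η) + ε / (2 * (k : ℝ))) := by
          rw [← Real.rpow_add hT0, ← Real.rpow_add hT0]; ring_nf
      _ ≤ T ^ ε := Real.rpow_le_rpow_of_exponent_le hT1 hexp
  -- the exponents of `R`
  have eR1 : R ^ (2 - 2 / (k : ℝ)) * R ^ (2 / (k : ℝ)) = R ^ 2 := by
    rw [← Real.rpow_add' hR0 (by ring_nf; norm_num)]
    rw [show (2 - 2 / (k : ℝ)) + 2 / (k : ℝ) = ((2 : ℕ) : ℝ) by push_cast; ring, Real.rpow_natCast]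
  have hq1 : 1 / (k : ℝ) ≤ 1 := by rw [div_le_one hk0]; exact hk1
  have hqpos : 0 < 1 / (k : ℝ) := by positivity
  have eR2 : R ^ (2 - 2 / (k : ℝ)) * R ^ (1 / (k : ℝ)) = R ^ (2 - 1 / (k : ℝ)) := by
    have hne : (2 - 2 / (k : ℝ)) + 1 / (k : ℝ) ≠ 0 := by
      have : (2 - 2 / (k : ℝ)) + 1 / (k : ℝ) = 2 - 1 / (k : ℝ) := by ring
      rw [this]; linarith
    rw [← Real.rpow_add' hR0 hne]; congr 1; ring
  have eR3 : R ^ (2 - 2 / (k : ℝ)) * R ^ (5 / (4 * (k : ℝ))) = R ^ (2 - 3 / (4 * (k : ℝ))) := by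
    have e35 : 5 / (4 * (k : ℝ)) = (5 / 4) * (1 / (k : ℝ)) := by field_simp
    have e34 : 3 / (4 * (k : ℝ)) = (3 / 4) * (1 / (k : ℝ)) := by field_simp
    have hne : (2 - 2 / (k : ℝ)) + 5 / (4 * (k : ℝ)) ≠ 0 := by
      have : (2 - 2 / (k : ℝ)) + 5 / (4 * (k : ℝ)) = 2 - 3 / (4 * (k : ℝ)) := by rw [e35, e34]; ring
      rw [this, e34]; nlinarith
    rw [← Real.rpow_add' hR0 hne]; congr 1; rw [e35, e34]; ring
  set Y : ℝ := (M : ℝ) * R ^ 2 + (M : ℝ) ^ 2 * R ^ (2 - 1 / (k : ℝ)) +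
    (M : ℝ) * T ^ (1 / (2 * (k : ℝ))) * R ^ (2 - 3 / (4 * (k : ℝ))) with hY
  have hY0 : 0 ≤ Y := by positivity
  have hlin : R ^ (2 - 2 / (k : ℝ)) * Lin = Y := by
    rw [hLin, hY, ← eR1, ← eR2, ← eR3]; ring
  have hIoc' : dps W (Finset.Ioc 1 M) a ≤ Cη ^ 2 * K₀ * T ^ ε * Y := by
    refine hIoc.trans ?_
    calc ((B : ℝ) + 1) * (((B : ℝ) + 1) * (R ^ (2 - 2 / (k : ℝ)) * (K₀ * (Mη ^ 2 * T ^ (ε / (2 * (k : ℝ))))) * Lin))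
        = (((B : ℝ) + 1) * ((B : ℝ) + 1)) * (K₀ * (Mη ^ 2 * T ^ (ε / (2 * (k : ℝ))))) *
          (R ^ (2 - 2 / (k : ℝ)) * Lin) := by ring
      _ ≤ (Cη ^ 2 * (M : ℝ) ^ (2 * η)) * (K₀ * (Mη ^ 2 * T ^ (ε / (2 * (k : ℝ))))) *
          (R ^ (2 - 2 / (k : ℝ)) * Lin) :=
          mul_le_mul_of_nonneg_right (mul_le_mul_of_nonneg_right hB2 (by positivity)) (by rw [hlin]; exact hY0)
      _ = Cη ^ 2 * K₀ * ((M : ℝ) ^ (2 * η) * (Mη ^ 2 * T ^ (ε / (2 * (k : ℝ))))) * Y := by rw [hlin]; ring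
      _ ≤ Cη ^ 2 * K₀ * T ^ ε * Y :=
          mul_le_mul_of_nonneg_right (mul_le_mul_of_nonneg_left hMpow (by positivity)) hY0
  -- the element `m = 1`: `R² ≤ T^ε · Y` (`M ≥ 1`, `T ≥ 1`)
  have hTε : (1 : ℝ) ≤ T ^ ε := Real.one_le_rpow hT1 hε.le
  have hone' : dps W ({1} : Finset ℕ) a ≤ T ^ ε * Y := by
    refine hone.trans ?_
    have h1 : R ^ 2 ≤ Y := by
      rw [hY]
      have : R ^ 2 ≤ (M : ℝ) * R ^ 2 := le_mul_of_one_le_left (by positivity) hM1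
      have h2 : 0 ≤ (M : ℝ) ^ 2 * R ^ (2 - 1 / (k : ℝ)) := by positivity
      have h3 : 0 ≤ (M : ℝ) * T ^ (1 / (2 * (k : ℝ))) * R ^ (2 - 3 / (4 * (k : ℝ))) := by positivity
      linarith
    calc R ^ 2 ≤ Y := h1
      _ ≤ T ^ ε * Y := le_mul_of_one_le_left hY0 hTε
  rw [hsplit]
  refine (dps_union_le W hdisj a).trans ?_
  calc 2 * (dps W ({1} : Finset ℕ) a + dps W (Finset.Ioc 1 M) a)
      ≤ 2 * (T ^ ε * Y + Cη ^ 2 * K₀ * T ^ ε * Y) := by linarith [hone', hIoc']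
    _ = (Cη ^ 2 * K₀ * 2 + 2) * T ^ ε * Y := by ring

end GuthMaynardS2K

end Literature.NumberTheory.LFunctions

end
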